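import Literature.AlgebraicGeometry.Frobenioids.Categories
import Mathlib.CategoryTheory.Limits.Types.Coproducts
import HarnessLib

/-!
# Frobenioids I, §0 pp. 14–15: the predicates `IsPseudoTerminal A`, `IsQuasiConnected A`
# (FACT-LIST F-0960 / F-0961) have REFUTABLE universal closures

Mochizuki, *The geometry of Frobenioids I: the general theory*, Kyushu J. Math. **62** (2008)
293–400, §0 "Categories", kurims text p. 14 ("We shall say that `A` is *pseudo-terminal* if, for every
object `B ∈ Ob(C)`, there exists a (not necessarily unique) arrow `B → A`") and p. 15 ("We shall say
that `A` is *quasi-connected* if it is either immobile or connected. Thus, connected objects are always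
quasi-connected") [cite: MochizukiFrdI2008, §0 pp.14-15].

Negative knowledge recorded next to `Categories.lean` (abc-iut-L1, STEP-0 calibration fragment; FACT-LIST
rows **F-0960** `IsPseudoTerminal`, **F-0961** `IsQuasiConnected`, class `preparatory`, kernel_closedness
`parametrised`), PROOF-ONLY (no definitions, no instances, no notation), abc-iut cell seat abc-iut-f-025.

Both rows are DEFINITIONS of the dictionary of §0 — predicates on an object `A` of an arbitrary category
`C` — not claims; print asserts them of no particular object.  Their universal closures ("every object of
every category is pseudo-terminal / quasi-connected") are false, and this file supplies the kernel
objects saying so, with the category of types as the witness category: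

* `not_isPseudoTerminal_pempty` — in `Type u` the empty type receives no arrow from `PUnit`
  (while `PUnit`, being terminal, IS pseudo-terminal: `isPseudoTerminal_punit`); hence
  `not_forall_isPseudoTerminal` (F-0960);
* `not_isQuasiConnected_sum` — in `Type u` a sum `X ⊕ Y` of two inhabited types is MOBILE (the identity
  and a constant map differ) and NOT connected (`X ⊔ Y` is a coproduct of two non-initial objects,
  `Types.binaryCoproductColimit`); hence `not_forall_isQuasiConnected` (F-0961).

The forms the tree consumes are the printed implications, already kernel theorems of `Categories.lean`:
`IsTerminalObj.isPseudoTerminal` ("terminal ⇒ pseudo-terminal"), `IsConnectedObj.isQuasiConnected`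
("connected ⇒ quasi-connected"), `IsTotallyEpimorphic.isQuasiConnected` ("in a totally epimorphic
category every object is quasi-connected", p. 15), and the instance forms at named data
(`ArchFrd.Cpt.std_isPseudoTerminal`, `ArchFrd.Thm36Sub.isPseudoTerminal_discretePUnit`,
`ModelFrobenioid.isPseudoTerminal_zeroObj_of_cofinal` / `…exists_isPseudoTerminal_of_cofinal` = [FrdII]
Thm 1.2 (iii), `ArchFrd.Thm36Sub.isPseudoTerminal_root` = [FrdII] Thm 3.6 (vi)).  So each row is
admissible ONLY as vocabulary / in instance form (FACT-LIST class «universal-closure REFUTED; instance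
forms in tree»).  Elementary category theory; nothing here bears on the disputed [IUTchIII] Cor. 3.12 or
takes a side; refuted is never a fact.
-/

namespace Literature.AlgebraicGeometry.Frobenioids

open CategoryTheory CategoryTheory.Limits

universe v u

/-! ### Generic transfer lemmas -/

section Generic

variable {C : Type u} [Category.{v} C]

/-- Pseudo-terminality propagates along any arrow: if every object maps to `A` and `A → B`, then every
object maps to `B`. [cite: MochizukiFrdI2008, §0 p.14] -/
theorem IsPseudoTerminal.of_hom {A B : C} (h : IsPseudoTerminal A) (f : A ⟶ B) : IsPseudoTerminal B :=
  fun X => ⟨(h X).some ≫ f⟩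

/-- A (genuinely) terminal object is pseudo-terminal (data version of
`IsTerminalObj.isPseudoTerminal`). [cite: MochizukiFrdI2008, §0 p.14] -/
theorem isPseudoTerminal_of_isTerminal {A : C} (h : IsTerminal A) : IsPseudoTerminal A :=
  IsTerminalObj.isPseudoTerminal ⟨h⟩

/-- An immobile object is quasi-connected (the first disjunct of the definition, p. 15).
[cite: MochizukiFrdI2008, §0 p.15] -/
theorem isQuasiConnected_of_not_isMobile {A : C} (h : ¬ IsMobile A) : IsQuasiConnected A :=
  Or.inl h

/-- A mobile object is quasi-connected iff it is connected. [cite: MochizukiFrdI2008, §0 p.15] -/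
theorem IsMobile.isQuasiConnected_iff {A : C} (h : IsMobile A) :
    IsQuasiConnected A ↔ IsConnectedObj A :=
  ⟨fun h' => h'.elim (fun h'' => absurd h h'') id, Or.inr⟩

end Generic

/-! ### The witness category `Type u` -/

section Types

/-- In `Type u` an object is nonempty in the sense of FrdI §0 (non-initial) iff it is inhabited
(`Types.initial_iff_empty`). [cite: MochizukiFrdI2008, §0 p.15] -/
theorem isNonemptyObj_type_iff (X : Type u) : IsNonemptyObj X ↔ Nonempty X := by
  rw [IsNonemptyObj, ← not_nonempty_iff, Types.initial_iff_empty, not_isEmpty_iff]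

/-- `PUnit` is pseudo-terminal in `Type u` (it is terminal). [cite: MochizukiFrdI2008, §0 p.14] -/
theorem isPseudoTerminal_punit : IsPseudoTerminal (PUnit.{u + 1} : Type u) :=
  fun _ => ⟨TypeCat.ofHom fun _ => PUnit.unit⟩

/-- **F-0960, a non-pseudo-terminal object:** the empty type receives no arrow from `PUnit` in `Type u`.
[cite: MochizukiFrdI2008, §0 p.14] -/
theorem not_isPseudoTerminal_pempty : ¬ IsPseudoTerminal (PEmpty.{u + 1} : Type u) := fun h =>
  (h PUnit.{u + 1}).elim fun f => (f PUnit.unit).elim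

/-- A sum of two inhabited types is mobile in `Type u`: the identity and the constant map at a point of
the left summand differ at a point of the right summand. [cite: MochizukiFrdI2008, §0 p.15] -/
theorem isMobile_sum (X Y : Type u) [Nonempty X] [Nonempty Y] : IsMobile (X ⊕ Y : Type u) := by
  obtain ⟨x⟩ := ‹Nonempty X›
  obtain ⟨y⟩ := ‹Nonempty Y›
  refine ⟨X ⊕ Y, 𝟙 _, TypeCat.ofHom fun _ => (Sum.inl x : X ⊕ Y), fun h => ?_⟩
  have h' : (𝟙 (X ⊕ Y) : X ⊕ Y ⟶ X ⊕ Y) (Sum.inr y) = (Sum.inl x : X ⊕ Y) := by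
    rw [h]; rfl
  exact Sum.inr_ne_inl h'

/-- A sum of two inhabited types is not connected in `Type u`: `Sum.inl`, `Sum.inr` exhibit it as a
coproduct of two non-initial objects (`Types.binaryCoproductColimit`). [cite: MochizukiFrdI2008, §0 p.15] -/
theorem not_isConnectedObj_sum (X Y : Type u) [Nonempty X] [Nonempty Y] :
    ¬ IsConnectedObj (X ⊕ Y : Type u) := fun h =>
  (h.2 X Y (TypeCat.ofHom Sum.inl) (TypeCat.ofHom Sum.inr) ((isNonemptyObj_type_iff X).mpr ‹_›)
    ((isNonemptyObj_type_iff Y).mpr ‹_›)).false (Types.binaryCoproductColimit X Y)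

/-- **F-0961, a non-quasi-connected object:** a sum of two inhabited types is mobile and not connected.
[cite: MochizukiFrdI2008, §0 p.15] -/
theorem not_isQuasiConnected_sum (X Y : Type u) [Nonempty X] [Nonempty Y] :
    ¬ IsQuasiConnected (X ⊕ Y : Type u) := fun h =>
  h.elim (fun h' => h' (isMobile_sum X Y)) (not_isConnectedObj_sum X Y)

end Types

/-! ### The fully quantified closures, refuted at `C = Type u` -/

/-- **FACT-LIST F-0960, universal closure REFUTED** (witness: the object `PEmpty` of `Type u`).  The
consumed forms `IsTerminalObj.isPseudoTerminal` and the instance lemmas at named data are theorems of the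
tree. [cite: MochizukiFrdI2008, §0 p.14] -/
theorem not_forall_isPseudoTerminal :
    ¬ ∀ (C : Type (u + 1)) [Category.{u} C] (A : C),
        Literature.AlgebraicGeometry.Frobenioids.IsPseudoTerminal A :=
  fun h => not_isPseudoTerminal_pempty.{u} (h (Type u) PEmpty)

/-- **FACT-LIST F-0961, universal closure REFUTED** (witness: the object `PUnit ⊕ PUnit` of `Type u`).
The consumed forms `IsConnectedObj.isQuasiConnected`, `IsTotallyEpimorphic.isQuasiConnected` are theorems
of the tree. [cite: MochizukiFrdI2008, §0 p.15] -/
theorem not_forall_isQuasiConnected :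
    ¬ ∀ (C : Type (u + 1)) [Category.{u} C] (A : C),
        Literature.AlgebraicGeometry.Frobenioids.IsQuasiConnected A :=
  fun h => not_isQuasiConnected_sum.{u} PUnit PUnit (h (Type u) (PUnit ⊕ PUnit))

end Literature.AlgebraicGeometry.Frobenioids
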